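import Mathlib
import HarnessLib
import Literature.MathematicalPhysics.StatisticalMechanics.PolymerProductBound
import Literature.MathematicalPhysics.StatisticalMechanics.PolymerFactorisationBound
import Literature.MathematicalPhysics.StatisticalMechanics.StrongWeightBlocks
import Literature.MathematicalPhysics.StatisticalMechanics.StrongWeightABKM
import Literature.MathematicalPhysics.StatisticalMechanics.LinearisedMapABKM

/-!
# Lemma 9.4 of [ABKM19] (map `P₂ = (e^{−H} − 1) ∘ K`) for the concrete torus data, zeroth order:
# `|Σ_{Y⊆X} (e^{−H}−1)^{X∖Y} K(Y)|_{k,X,T_φ} ≤ Σ_Y (8e^{1/4}‖H‖_{k,0})^{|X∖Y|_k} ∏_{Z∈𝒞(Y)} (C A^{−|Z|_k}) · w_k^X(φ)`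

Assembly of the abstract bricks `PolymerProductBound.tayNormLE_sum_bprod_mul` (P₂ bound),
`PolymerFactorisationBound.tayNormLE_of_factorises` (Lemma 8.3 (i)), `StrongWeightBlocks` ((w5)),
`StrongWeightABKM` (Lemma 9.3 for the strong weight) for the parameters `abkmNormParams` and a weight
tower with the conclusions of Theorem 7.1 (`AbkmWeightBounds`):

* `weight_empty_of_union` — `w_k^∅ = 1` from (w3);
* `tayNormLE_expNegH_sub_one_strong_abkm` — `‖e^{−H(B)} − 1‖_{k,B} ≤ 8e^{1/4}‖H‖_{k,0}`;
* **`tayNormLE_P2_abkm`** — the displayed bound, for a `k`-polymer `X`, `‖H‖_{k,0} ≤ ⅛`,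
  `K` factorising on scale `k` with `K(∅) = 1`, `C^{r₀}`, local, and `‖K‖_k^{(A)} ≤ C`.

Everything is proved; no named fact.

## References
* S. Adams, S. Buchholz, R. Kotecký, S. Müller, arXiv:1910.13564, Lemma 9.4 ((9.18)–(9.19)), Lemma 8.3,
  Theorem 7.1 (w3), (w5) [AdamsBuchholzKoteckyMuller2019].
-/

noncomputable section

namespace Literature.MathematicalPhysics.StatisticalMechanics.GradientRG

open scoped BigOperators Classical
open Finset Matrix
open Literature.MathematicalPhysics.StatisticalMechanics.TorusPolymer
  (IsPolymer Separated blocks polys bprod blockOf thicken mem_polys mem_blocks isPolymer_blockOf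
    isPolymer_empty)
open Literature.Barriers.CriticalPhenomena.LongRangePhi4.Polymer (IsConn components)
open Literature.MathematicalPhysics.QuantumFieldTheory

variable {d M : ℕ} [NeZero M]

/-- `w(∅) = 1` for a positive weight factorising over separated unions ((w3) with `X = Y = ∅`).
[cite: AdamsBuchholzKoteckyMuller2019, Theorem 7.1 (w3)] -/
theorem weight_empty_of_union {s : ℕ} {w : Finset (Fin d → ZMod M) → ((Fin d → ZMod M) → ℝ) → ℝ}
    (hw : ∀ X Y, IsPolymer s X → IsPolymer s Y → Separated (s + 1) X Y → ∀ φ, w (X ∪ Y) φ = w X φ * w Y φ)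
    (hpos : ∀ φ, 0 < w ∅ φ) (φ : (Fin d → ZMod M) → ℝ) : w ∅ φ = 1 := by
  have h := hw ∅ ∅ (isPolymer_empty s) (isPolymer_empty s) (fun x hx => absurd hx (by simp)) φ
  rw [Finset.empty_union] at h
  have hp := hpos φ
  field_simp at h ⊢
  nlinarith [h, hp]

/-- **`‖e^{−H(B)} − 1‖_{T, W_k^B} ≤ 8e^{1/4}‖H‖_{k,0}`** for the concrete strong weight (`‖H‖_{k,0} ≤ ⅛`).
[cite: AdamsBuchholzKoteckyMuller2019, Lemma 9.3 (9.16)] -/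
theorem tayNormLE_expNegH_sub_one_strong_abkm {L N Mord R k p : ℕ} {h : ℝ} (hd : 2 ≤ d)
    (hLodd : Odd L) (hM : M = L ^ N) (hk : k ≤ N) (hh : 0 < h) (hMord : d / 2 + 1 ≤ Mord)
    (hp : d / 2 + 1 ≤ p) {x : Fin d → ZMod M} {S : Finset (Fin d → ZMod M)}
    (hBS : blockOf (L ^ k) x ⊆ S) {H : RelevantHamiltonian ℂ d} (r₀ : ℕ)
    (hH : hamNorm (fieldWt h (L : ℝ) d k) ((L : ℝ) ^ k) (blockOf (L ^ k) x).card H ≤ 1 / 8) :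
    TayNormLE (fieldGauge (fieldWt h (L : ℝ) d k) ((L : ℝ) ^ k) p S) r₀
      (expWeight (strongCoef h N k • derivForm (L : ℝ) k (diffIndex d Mord)
        (boxDensity (boxRad R L k) (boxWt (L : ℝ) d k) (blockOf (L ^ k) x))))
      (fun ψ : (Fin d → ZMod M) → ℝ => expNegH H (blockOf (L ^ k) x) ψ - 1)
      (8 * Real.exp (1 / 4) * hamNorm (fieldWt h (L : ℝ) d k) ((L : ℝ) ^ k) (blockOf (L ^ k) x).card H) := by
  have hneg : (fun ψ : (Fin d → ZMod M) → ℝ => expNegH H (blockOf (L ^ k) x) ψ - 1) =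
      fun ψ => Complex.exp (eval (-H) (blockOf (L ^ k) x) ψ) - 1 := by
    funext ψ
    have : eval (-H) (blockOf (L ^ k) x) ψ = -(eval H (blockOf (L ^ k) x) ψ) := by
      have h1 := eval_add H (-H) (blockOf (L ^ k) x) ψ
      rw [add_neg_cancel, eval_zero] at h1
      exact eq_neg_of_add_eq_zero_right h1.symm
    simp [expNegH, this]
  have hnorm : hamNorm (fieldWt h (L : ℝ) d k) ((L : ℝ) ^ k) (blockOf (L ^ k) x).card (-H) =
      hamNorm (fieldWt h (L : ℝ) d k) ((L : ℝ) ^ k) (blockOf (L ^ k) x).card H := by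
    unfold hamNorm; simp only [Pi.neg_apply, norm_neg]
  rw [hneg, ← hnorm]
  exact tayNormLE_cexp_eval_sub_one_strong_abkm (R := R) hd hLodd hM hk hh hMord hp hBS r₀ (hnorm ▸ hH)

/-- **[ABKM19] Lemma 9.4 (zeroth order) for the torus data.**  Let `P = abkmNormParams …`, the weight
tower satisfy `AbkmWeightBounds` (`h² ≥ h₀²`, `δ₀, δ₁ > 0`), `d ≥ 2`, `L` odd,
`M = L^N`, `k + 1 ≤ N`, `⌊d/2⌋+1 ≤ p`, `⌊d/2⌋+1 ≤ M_ord`, `A > 0`; let `X` be a `k`-polymer,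
`‖H‖_{k,0} ≤ ⅛` (at `(𝔥_k, L^k, L^{dk})`), and `K` factorise on scale `k` with `K(∅) = 1`, be `C^{r₀}` and
local on connected `k`-polymers with `‖K‖_k^{(A)} ≤ C` (`C ≥ 0`).  Then
`|Σ_{Y ∈ 𝓟_k(X)} (e^{−H}−1)^{X∖Y} K(Y)|_{T_X, w_k^X} ≤ Σ_Y (8e^{1/4}‖H‖)^{|𝓑_k(X∖Y)|} ∏_{Z ∈ 𝒞(Y)} C A^{−|Z|_k}`.
[cite: AdamsBuchholzKoteckyMuller2019, Lemma 9.4 (9.19)] -/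
theorem tayNormLE_P2_abkm {L N Mord R n p r₀ : ℕ} {θbar lam μ δ₁ δ₀ A𝒫 h A : ℝ}
    {𝒞 : ℕ → (Fin d → ZMod M) → ℝ} (hd : 2 ≤ d) (hLodd : Odd L)
    (hM : M = L ^ N) {k : ℕ} (hkN : k + 1 ≤ N) (hp : d / 2 + 1 ≤ p) (hMord : d / 2 + 1 ≤ Mord)
    (hB : AbkmWeightBounds L N Mord R n θbar lam μ δ₁ δ₀ A𝒫 𝒞
      (abkmWeightData L N Mord R θbar (schedDelta δ₀ δ₁ N) 𝒞))
    (hδ₀ : 0 < δ₀) (hδ₁ : 0 < δ₁) (hh : 0 < h) (hh0 : hZeroSq d R δ₀ δ₁ ≤ h ^ 2) (hA : 0 < A)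
    {X : Finset (Fin d → ZMod M)} (hX : IsPolymer (L ^ k) X)
    {H : RelevantHamiltonian ℂ d}
    (hH : hamNorm (fieldWt h (L : ℝ) d k) ((L : ℝ) ^ k) (L ^ (d * k)) H ≤ 1 / 8)
    {K : Finset (Fin d → ZMod M) → ((Fin d → ZMod M) → ℝ) → ℂ} {C : ℝ} (hC : 0 ≤ C)
    (hK : WeakNormLE (abkmNormParams L N Mord R p r₀ h θbar A (schedDelta δ₀ δ₁ N) 𝒞) k K C)
    (hKfac : Factorises (L ^ k) K) (hK0 : ∀ φ, K ∅ φ = 1) (hKd : ∀ Y, ContDiff ℝ r₀ (K Y))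
    (hKloc : ∀ Y, IsPolymer (L ^ k) Y → IsConn Y →
      IsGaugeLocal ((abkmNormParams L N Mord R p r₀ h θbar A (schedDelta δ₀ δ₁ N) 𝒞).gauge k Y) (K Y)) :
    TayNormLE ((abkmNormParams L N Mord R p r₀ h θbar A (schedDelta δ₀ δ₁ N) 𝒞).gauge k X) r₀
      ((abkmWeightData L N Mord R θbar (schedDelta δ₀ δ₁ N) 𝒞).weight k X)
      (fun φ => ∑ Y ∈ polys (L ^ k) X,
        bprod (L ^ k) (fun B => expNegH H B φ - 1) (X \ Y) * K Y φ)
      (∑ Y ∈ polys (L ^ k) X, (∏ _B ∈ blocks (L ^ k) (X \ Y),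
        8 * Real.exp (1 / 4) * hamNorm (fieldWt h (L : ℝ) d k) ((L : ℝ) ^ k) (L ^ (d * k)) H) *
        ∏ Z ∈ components Y, C * (abkmNormParams L N Mord R p r₀ h θbar A (schedDelta δ₀ δ₁ N) 𝒞).aFactor k Z) := by
  set P := abkmNormParams L N Mord R p r₀ h θbar A (schedDelta δ₀ δ₁ N) 𝒞 with hP
  set W := abkmWeightData L N Mord R θbar (schedDelta δ₀ δ₁ N) 𝒞 with hW
  set s := L ^ k with hs
  have hkN' : k ≤ N := by omega
  have hL0 : (0 : ℝ) < L := by exact_mod_cast hLodd.pos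
  obtain ⟨t, ht⟩ : ∃ t, N = k + t := ⟨N - k, by omega⟩
  have hMt : M = s * L ^ t := by rw [hs, ← pow_add, ← ht]; exact hM
  have htodd : Odd (L ^ t) := hLodd.pow
  have hsodd : Odd s := hLodd.pow
  have h𝔥 : 0 < P.𝔥 k := fieldWt_pos hh hL0 d k
  have hR : 0 < P.R k := by show (0 : ℝ) < (L : ℝ) ^ k; positivity
  -- strong family and (w5)
  set G : ℕ → Finset (Fin d → ZMod M) → Matrix (Fin d → ZMod M) (Fin d → ZMod M) ℝ :=
    fun j Y => strongCoef h N j • derivForm (L : ℝ) j (diffIndex d Mord)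
      (boxDensity (boxRad R L j) (boxWt (L : ℝ) d j) Y) with hG
  have hGs : W.StrongDominated G fun _ X Y => Disjoint X Y :=
    hB.strong (diffIndex d Mord) (fun α hα => hα) (strongCoef h N) (strongCoef_le hδ₀ hδ₁ hh hh0)
  -- gauges of blocks / sub-polymers are dominated by the gauge of `X`
  have hgauge : ∀ Y ⊆ X, ∀ ξ, ‖P.gauge k Y ξ‖ ≤ ‖P.gauge k X ξ‖ := fun Y hY ξ =>
    norm_fieldGauge_mono_set _ _ _ (TorusPolymer.thicken_mono _ hY) ξ
  -- the block functional `F = e^{−H} − 1`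
  have hcard : ∀ x, (blockOf s x).card = L ^ (d * k) := fun x => by
    rw [TorusPolymer.card_blockOf hMt hsodd htodd x, hs, ← pow_mul, mul_comm]
  have hF : ∀ B ∈ blocks s X, TayNormLE (P.gauge k B) r₀ (expWeight (G k B))
      (fun ψ => expNegH H B ψ - 1)
      (8 * Real.exp (1 / 4) * hamNorm (fieldWt h (L : ℝ) d k) ((L : ℝ) ^ k) (L ^ (d * k)) H) := by
    intro B hBm
    obtain ⟨x, -, rfl⟩ := mem_blocks.1 hBm
    have hH' : hamNorm (fieldWt h (L : ℝ) d k) ((L : ℝ) ^ k) (blockOf s x).card H ≤ 1 / 8 := by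
      rw [hcard x]; exact hH
    have := tayNormLE_expNegH_sub_one_strong_abkm (R := R) (N := N) (Mord := Mord) hd hLodd hM hkN' hh
      hMord hp (TorusPolymer.subset_thicken (P.rad k) (blockOf s x)) r₀ hH'
    rw [hcard x] at this
    exact this
  have hFd : ∀ B ∈ blocks s X, ContDiff ℝ r₀ (fun ψ : (Fin d → ZMod M) → ℝ => expNegH H B ψ - 1) :=
    fun B _ => ((contDiff_eval H B (n := r₀)).neg.cexp).sub contDiff_const
  have hFloc : ∀ B ∈ blocks s X, IsGaugeLocal (P.gauge k B)
      (fun ψ : (Fin d → ZMod M) → ℝ => expNegH H B ψ - 1) := fun B _ =>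
    IsGaugeLocal.op₁ _ (fun z : ℂ => z - 1) (isGaugeLocal_cexp_neg_eval h𝔥.ne' hR.ne' hp
      (TorusPolymer.subset_thicken _ _) H)
  have hleb : ∀ B ∈ blocks s X, ∀ ξ, ‖P.gauge k B ξ‖ ≤ ‖P.gauge k X ξ‖ := fun B hBm =>
    hgauge B (hX.subset_of_mem_blocks hBm)
  have ha : ∀ B ∈ blocks s X, (0 : ℝ) ≤
      8 * Real.exp (1 / 4) * hamNorm (fieldWt h (L : ℝ) d k) ((L : ℝ) ^ k) (L ^ (d * k)) H :=
    fun _ _ => by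
      have := hamNorm_nonneg (fieldWt_pos hh hL0 d k).le (by positivity : (0 : ℝ) ≤ (L : ℝ) ^ k)
        (L ^ (d * k)) H
      positivity
  -- `K` on the sub-polymers `Y ⊆ X`: Lemma 8.3 (i)
  have hwU : ∀ X' Y', IsPolymer s X' → IsPolymer s Y' → Separated (s + 1) X' Y' →
      ∀ φ, W.weight k (X' ∪ Y') φ = W.weight k X' φ * W.weight k Y' φ := fun X' Y' _ _ hsep φ =>
    WeightData.weight_union hB.dominated hB.isLocal hB.additive (k := k) hsep φ
  have hw0 : ∀ φ, W.weight k ∅ φ = 1 := weight_empty_of_union hwU (fun φ => W.weight_pos k ∅ φ)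
  have hMo : Odd M := by rw [hM]; exact hLodd.pow
  have hKY : ∀ Y ∈ polys s X, TayNormLE (P.gauge k Y) r₀ (W.weight k Y) (K Y)
      (∏ Z ∈ components Y, C * P.aFactor k Z) := by
    intro Y hY
    obtain ⟨hYX, hYp⟩ := mem_polys.1 hY
    refine tayNormLE_of_factorises hMt hsodd htodd (P.gauge k Y) (fun Z => P.gauge k Z) hwU hw0 hKfac hK0 hYp
      (fun Z hZ => ?_) (fun Z hZ ξ => ?_) (fun Z _ => hKd Z) (fun Z hZ => ?_) (fun Z _ => ?_)
    · obtain ⟨hZp, hZc⟩ := TorusPolymer.IsPolymer.of_mem_components hMo hsodd hYp hZ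
      exact hK Z hZp hZc
    · have hZY : Z ⊆ Y := by
        rw [Literature.Barriers.CriticalPhenomena.LongRangePhi4.Polymer.eq_biUnion_components Y]
        exact Finset.subset_biUnion_of_mem id hZ
      exact norm_fieldGauge_mono_set _ _ _ (TorusPolymer.thicken_mono _ hZY) ξ
    · obtain ⟨hZp, hZc⟩ := TorusPolymer.IsPolymer.of_mem_components hMo hsodd hYp hZ
      exact hKloc Z hZp hZc
    · exact mul_nonneg hC (WeakNormLE.aFactor_pos hA k Z).le
  have hlep : ∀ Y ∈ polys s X, ∀ ξ, ‖P.gauge k Y ξ‖ ≤ ‖P.gauge k X ξ‖ := fun Y hY =>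
    hgauge Y (mem_polys.1 hY).1
  have hKlocY : ∀ Y ∈ polys s X, IsGaugeLocal (P.gauge k Y) (K Y) := by
    -- `K(Y) = ∏_{Z ∈ 𝒞(Y)} K(Z)`, each factor local for the smaller gauge of `Z ⊆ Y`
    intro Y hY
    obtain ⟨hYX, hYp⟩ := mem_polys.1 hY
    have hpoly : ∀ Z ∈ components Y, IsPolymer s Z := fun Z hZ =>
      (TorusPolymer.IsPolymer.of_mem_components hMo hsodd hYp hZ).1
    have hsep := TorusPolymer.pairwise_separated_components hMt hsodd htodd hYp
    have hKeq : K Y = fun φ => ∏ Z ∈ components Y, K Z φ := by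
      funext φ
      conv_lhs => rw [Literature.Barriers.CriticalPhenomena.LongRangePhi4.Polymer.eq_biUnion_components Y]
      exact eq_prod_of_factorises hKfac hK0 _ hpoly hsep φ
    rw [hKeq]
    refine IsGaugeLocal.prod _ fun Z hZ => ?_
    obtain ⟨hZp, hZc⟩ := TorusPolymer.IsPolymer.of_mem_components hMo hsodd hYp hZ
    have hZY : Z ⊆ Y := by
      rw [Literature.Barriers.CriticalPhenomena.LongRangePhi4.Polymer.eq_biUnion_components Y]
      exact Finset.subset_biUnion_of_mem id hZ
    exact (hKloc Z hZp hZc).of_norm_le fun ξ => norm_fieldGauge_mono_set _ _ _ (TorusPolymer.thicken_mono _ hZY) ξ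
  have hc : ∀ Y ∈ polys s X, (0 : ℝ) ≤ ∏ Z ∈ components Y, C * P.aFactor k Z := fun Y _ =>
    Finset.prod_nonneg fun Z _ => mul_nonneg hC (WeakNormLE.aFactor_pos hA k Z).le
  have hw : ∀ Y ∈ polys s X, ∀ φ, (∏ B ∈ blocks s (X \ Y), expWeight (G k B) φ) * W.weight k Y φ ≤
      W.weight k X φ := fun Y hY φ =>
    weight_mul_prod_strongWeight_le hB.dominated hB.monotone hGs k s hX (mem_polys.1 hY).2 (mem_polys.1 hY).1 φ
  exact tayNormLE_sum_bprod_mul s (P.gauge k X) (fun B => P.gauge k B) (fun Y => P.gauge k Y) X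
    hF hleb hFd hFloc ha hKY hlep (fun Y _ => hKd Y) hKlocY hc hw

end Literature.MathematicalPhysics.StatisticalMechanics.GradientRG

end
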